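import Literature.NumberTheory.Automorphic.UnitaryCurveConeFrameCoordinates
import Mathlib.Analysis.Complex.MeanValue
import Mathlib.MeasureTheory.Measure.Haar.Basic
import Mathlib.MeasureTheory.Integral.Prod
import HarnessLib

/-!
# The torus of a rank-2 cone frame, the closed embedding `U(σ_{w₁}J)(ℂ) ↪ M₂(ℂ)`, and the ROTATION AVERAGE
# `∫ α · F(ζ) dν = F(0) · ∫ α dν`

Topic `NumberTheory/Automorphic`; namespace `Literature.NumberTheory.Automorphic.UnitaryCurveForms`.  THEOREMS ONLY (no `def`, no instance, no
notation, no named fact, no `sorry`); imports ★ `UnitaryCurveConeFrameCoordinates` (frame functionals, frame disc) and Mathlib (`MeanValue`: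
`DiffContOnCl.circleAverage`; Haar measures; Fubini).  Second of three files of the chart-free reproducing kernel (F0P5-p01 (g2)).

SETTING as in ★ `UnitaryCurveConeFrameCoordinates`: a cone frame `𝔣 = (v₀, t₀)` with `hvt : ⟪v₀, t₀⟫ = 0`, `U := archLocal E 2 J w₁ = U(σ_{w₁}J) ≤
GL₂(ℂ)` (★ `UnitaryGroupArchimedeanPlaces`).

MAIN RESULTS.
* §1 `conjTranspose_mul_mul_eq_of_forall` (sesquilinear test for `Yᴴ H Y = H`), **`exists_frameTorus`**: for `|e| = 1` the matrix fixing `v₀` and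
  multiplying `t₀` by `e` lies in `U` — a point of the compact torus `K_∞ = U ∩ Stab(ℂ v₀)` — and `frameCoords_torus_mul`: left multiplication by it
  multiplies the `t₀`-coordinates by `e` and fixes the `v₀`-coordinates (so it ROTATES the disc coordinate `ζ = y∕x` by `e` and preserves the
  coordinate moduli).
* §2 `isClosedEmbedding_coe_archLocal` (`U → M₂(ℂ)` is a closed embedding when `σ_{w₁}J` is invertible; Mathlib's topology on units + continuity of
  inversion), **`isCompact_frameCoords_le`** (the sublevel sets `{u ∈ U | |y|² + |x|² + |y′|² + |x′|² ≤ R}` of the frame-coordinate moduli are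
  COMPACT — the support of the kernel's bump).
* §3 **`integral_mul_eq_mul_integral_of_rotation`** (abstract, any topological group `U` with a left-invariant measure `ν` finite on compacts):
  for `α : U → ℝ` continuous with compact support, `ζ : U → ℂ` continuous into the disc `|ζ| < r`, `F` holomorphic on that disc, and every rotation
  `ζ ↦ e^{iθ} ζ` realised by a left translation fixing `α`:  `∫ α(u) F(ζ(u)) dν(u) = F(0) · ∫ α dν`.  PROOF: left-invariance makes the integral equal
  to its average over `θ ∈ [0, 2π]`; Fubini on `[0, 2π] × tsupport α` (bounded continuous integrand, finite measures); the inner integral is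
  `2π · circleAverage F 0 |ζ(u)| = 2π · F(0)` by Mathlib's `DiffContOnCl.circleAverage` after a periodic shift.
Borel (1997) §2.13–2.14 (`φ ↦ φ ∗ α`, reproducing by convolution) and §5.13; Harish-Chandra (1966) §8 Thm. 1.  Cell `hodgecm-mathlib`, floor 0,
K-groundwork for TP₂ (`Lines/F0_P5TP2SpectralProjection`, stub (K₂)).  HC_CM is proved only modulo the printed citations until rung 0 closes;
nothing printed is asserted here.

## References
* [Borel1997] A. Borel, *Automorphic forms on SL₂(ℝ)*, Cambridge Tracts in Math. 130 (1997), §2.13–2.14, §5.13.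
* [HarishChandra1966] Harish-Chandra, *Discrete series for semisimple Lie groups II*, Acta Math. 116 (1966), §8 Thm. 1.
* [BergeronMillsonMoeglin2016Balls] N. Bergeron, J. Millson, C. Moeglin, Acta Math. 216 (2016), Part 2 §1.3.
* [Jacobson] N. Jacobson, *Basic Algebra I*, 2nd ed. (1985), Ch. V §7.  [PlatonovRapinchuk1994] V. Platonov, A. Rapinchuk, *Algebraic Groups and
  Number Theory* (1994), §3.2 (real points of unitary groups as closed subgroups of `GL_N`).
-/

set_option autoImplicit false

noncomputable section

open Matrix MeasureTheory NumberField NumberField.InfinitePlace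
open scoped Matrix ComplexConjugate ComplexOrder ContDiff
open Literature.NumberTheory.Automorphic Literature.NumberTheory.Automorphic.UnitaryGroup
open Literature.AlgebraicGeometry.ShimuraVarieties Literature.AlgebraicGeometry.ShimuraVarieties.UnitaryCurveCone

namespace Literature.NumberTheory.Automorphic.UnitaryCurveForms

variable {E : Type} [Field E] {J : Matrix (Fin 2) (Fin 2) E} {w₁ : {w : InfinitePlace E // IsComplex w}}
  {𝔣 : ConeFrame E J w₁}

/-! ## §1 The torus `K_∞` of the frame and its action on frame coordinates -/

/-- **Sesquilinear test for `Yᴴ H Y = H`**: it suffices that `Y` preserves the form `⟪w, w′⟫ = wᴴ H w′`. [cite: Jacobson, Ch. V §7 pp. 150–151] -/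
theorem conjTranspose_mul_mul_eq_of_forall {m : Type*} [Fintype m] [DecidableEq m] {Y H : Matrix m m ℂ}
    (h : ∀ w w', star (Y *ᵥ w) ⬝ᵥ (H *ᵥ (Y *ᵥ w')) = star w ⬝ᵥ (H *ᵥ w')) : Yᴴ * H * Y = H := by
  ext i j
  have key : ∀ w w', star (Y *ᵥ w) ⬝ᵥ (H *ᵥ (Y *ᵥ w')) = star w ⬝ᵥ ((Yᴴ * H * Y) *ᵥ w') := fun w w' => by
    rw [star_mulVec, ← dotProduct_mulVec, mulVec_mulVec, mulVec_mulVec, Matrix.mul_assoc]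
  have hij := (key (Pi.single i 1) (Pi.single j 1)).symm.trans (h (Pi.single i 1) (Pi.single j 1))
  simpa only [Pi.star_single, star_one, single_one_dotProduct, mulVec_single_one, Matrix.col_apply] using hij

/-- **The torus of the frame.**  For `|e| = 1` the matrix fixing `v₀` and multiplying `t₀` by `e` is an element of
`U(σ_{w₁}J)(ℂ)` — a point of the compact torus `K_∞ = U ∩ Stab(ℂ v₀)` fixing the centre `[v₀]` of the disc and ROTATING the disc
coordinate by `e`. [cite: Borel1997, §5.13] [cite: BergeronMillsonMoeglin2016Balls, Part 2 §1.3] -/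
theorem exists_frameTorus (hvt : star 𝔣.v₀ ⬝ᵥ (J.map w₁.1.embedding *ᵥ 𝔣.t₀) = 0) {e : ℂ} (he : ‖e‖ = 1) :
    ∃ k : archLocal E 2 J w₁, ((k : GL (Fin 2) ℂ) : Matrix (Fin 2) (Fin 2) ℂ) *ᵥ 𝔣.v₀ = 𝔣.v₀ ∧
      ((k : GL (Fin 2) ℂ) : Matrix (Fin 2) (Fin 2) ℂ) *ᵥ 𝔣.t₀ = e • 𝔣.t₀ := by
  have he0 : e ≠ 0 := fun h => by simp [h] at he
  obtain ⟨πt, πv, hdec⟩ := exists_frameFunctionals 𝔣 hvt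
  obtain ⟨Y, hYv, hYt⟩ := exists_matrix_frame_action (𝔣 := 𝔣) hvt 0 1 e 0
  obtain ⟨Y', hY'v, hY't⟩ := exists_matrix_frame_action (𝔣 := 𝔣) hvt 0 1 e⁻¹ 0
  simp only [zero_smul, zero_add, add_zero, one_smul] at hYv hYt hY'v hY't
  have h1 : Y * Y' = 1 :=
    eq_of_mulVec_frame hdec (by rw [← mulVec_mulVec, hY'v, hYv, one_mulVec])
      (by rw [← mulVec_mulVec, hY't, mulVec_smul, hYt, smul_smul, inv_mul_cancel₀ he0, one_smul, one_mulVec])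
  have h2 : Y' * Y = 1 :=
    eq_of_mulVec_frame hdec (by rw [← mulVec_mulVec, hYv, hY'v, one_mulVec])
      (by rw [← mulVec_mulVec, hYt, mulVec_smul, hY't, smul_smul, mul_inv_cancel₀ he0, one_smul, one_mulVec])
  have hee : starRingEnd ℂ e * e = 1 := by
    rw [Complex.conj_mul', he]; norm_num
  have hform : ∀ w w', star (Y *ᵥ w) ⬝ᵥ (J.map w₁.1.embedding *ᵥ (Y *ᵥ w')) =
      star w ⬝ᵥ (J.map w₁.1.embedding *ᵥ w') := by
    intro w w'
    obtain ⟨a, d, hw⟩ : ∃ a d : ℂ, w = a • 𝔣.t₀ + d • 𝔣.v₀ := ⟨_, _, hdec w⟩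
    obtain ⟨a', d', hw'⟩ : ∃ a d : ℂ, w' = a • 𝔣.t₀ + d • 𝔣.v₀ := ⟨_, _, hdec w'⟩
    have hYw : Y *ᵥ w = (a * e) • 𝔣.t₀ + d • 𝔣.v₀ := by
      rw [hw, mulVec_add, mulVec_smul, mulVec_smul, hYt, hYv, smul_smul]
    have hYw' : Y *ᵥ w' = (a' * e) • 𝔣.t₀ + d' • 𝔣.v₀ := by
      rw [hw', mulVec_add, mulVec_smul, mulVec_smul, hYt, hYv, smul_smul]
    rw [hYw, hYw', hw, hw', form_frame_combination 𝔣 hvt, form_frame_combination 𝔣 hvt, map_mul]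
    calc starRingEnd ℂ a * starRingEnd ℂ e * (a' * e) * (star 𝔣.t₀ ⬝ᵥ (J.map w₁.1.embedding *ᵥ 𝔣.t₀)) +
          starRingEnd ℂ d * d' * (star 𝔣.v₀ ⬝ᵥ (J.map w₁.1.embedding *ᵥ 𝔣.v₀))
        = starRingEnd ℂ a * a' * (starRingEnd ℂ e * e) * (star 𝔣.t₀ ⬝ᵥ (J.map w₁.1.embedding *ᵥ 𝔣.t₀)) +
          starRingEnd ℂ d * d' * (star 𝔣.v₀ ⬝ᵥ (J.map w₁.1.embedding *ᵥ 𝔣.v₀)) := by ring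
      _ = _ := by rw [hee, mul_one]
  refine ⟨⟨⟨Y, Y', h1, h2⟩, ?_⟩, hYv, hYt⟩
  rw [mem_archLocal_iff_conjTranspose]
  exact conjTranspose_mul_mul_eq_of_forall hform

/-- **Frame coordinates under the torus**: left multiplication by `k` (`k v₀ = v₀`, `k t₀ = e t₀`) multiplies the `t₀`-coordinates of
`M v₀`, `M t₀` by `e` and fixes their `v₀`-coordinates — so it rotates the disc coordinate `ζ = y∕x` by `e`, multiplies the factor
`x y′ − x′ y` by `e`, and preserves all four coordinate moduli when `|e| = 1`. [cite: Borel1997, §5.13] -/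
theorem frameCoords_torus_mul (hvt : star 𝔣.v₀ ⬝ᵥ (J.map w₁.1.embedding *ᵥ 𝔣.t₀) = 0) {πt πv : (Fin 2 → ℂ) →ₗ[ℂ] ℂ}
    (hdec : ∀ w, w = πt w • 𝔣.t₀ + πv w • 𝔣.v₀) {k M : Matrix (Fin 2) (Fin 2) ℂ} {e : ℂ}
    (hkv : k *ᵥ 𝔣.v₀ = 𝔣.v₀) (hkt : k *ᵥ 𝔣.t₀ = e • 𝔣.t₀) (w : Fin 2 → ℂ) :
    πt ((k * M) *ᵥ w) = e * πt (M *ᵥ w) ∧ πv ((k * M) *ᵥ w) = πv (M *ᵥ w) := by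
  refine frameFunctionals_eq hvt hdec ?_
  conv_lhs => rw [← mulVec_mulVec, hdec (M *ᵥ w), mulVec_add, mulVec_smul, mulVec_smul, hkt, hkv, smul_smul,
    mul_comm]

/-! ## §2 Topology: `U(σ_{w₁}J)(ℂ) → M₂(ℂ)` is a closed embedding; compact sublevel sets of the frame coordinates -/

/-- The coercion `U(σ_{w₁}J)(ℂ) → M₂(ℂ)` is a CLOSED EMBEDDING (Mathlib's topology on units is induced by `g ↦ (g, g⁻¹)` and inversion
is continuous at invertible matrices; the range `{M | Mᴴ Jw M = Jw}` is closed and consists of invertible matrices since `Jw` is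
invertible). [cite: PlatonovRapinchuk1994, §3.2] -/
theorem isClosedEmbedding_coe_archLocal (hJu : IsUnit (J.map w₁.1.embedding)) :
    Topology.IsClosedEmbedding (fun u : archLocal E 2 J w₁ => ((u : GL (Fin 2) ℂ) : Matrix (Fin 2) (Fin 2) ℂ)) := by
  have hval : Topology.IsEmbedding (Units.val : GL (Fin 2) ℂ → Matrix (Fin 2) (Fin 2) ℂ) := by
    refine Units.isEmbedding_val_mk' (f := fun A : Matrix (Fin 2) (Fin 2) ℂ => A⁻¹) ?_ ?_
    · intro A hA
      refine (continuousAt_matrix_inv A ?_).continuousWithinAt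
      obtain ⟨d, hd⟩ := (Matrix.isUnit_iff_isUnit_det A).mp hA
      rw [← hd]
      exact NormedRing.inverse_continuousAt d
    · intro u
      exact (Matrix.coe_units_inv u).symm
  refine ⟨hval.comp Topology.IsEmbedding.subtypeVal, ?_⟩
  have hrange : Set.range (fun u : archLocal E 2 J w₁ => ((u : GL (Fin 2) ℂ) : Matrix (Fin 2) (Fin 2) ℂ)) =
      {M | Mᴴ * J.map w₁.1.embedding * M = J.map w₁.1.embedding} := by
    ext M
    constructor
    · rintro ⟨u, rfl⟩
      exact (mem_archLocal_iff_conjTranspose E 2 J w₁ _).1 u.2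
    · intro hM
      obtain ⟨Ji, hJi⟩ := hJu.exists_left_inv
      have hleft : (Ji * Mᴴ * J.map w₁.1.embedding) * M = 1 := by
        rw [Matrix.mul_assoc, Matrix.mul_assoc, ← Matrix.mul_assoc Mᴴ, hM, hJi]
      have hright : M * (Ji * Mᴴ * J.map w₁.1.embedding) = 1 := mul_eq_one_comm.1 hleft
      exact ⟨⟨⟨M, Ji * Mᴴ * J.map w₁.1.embedding, hright, hleft⟩,
        (mem_archLocal_iff_conjTranspose E 2 J w₁ _).2 hM⟩, rfl⟩
  rw [hrange]
  exact isClosed_eq ((continuous_id.matrix_conjTranspose.mul continuous_const).mul continuous_id) continuous_const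

/-- **Compact sublevel sets of the frame-coordinate moduli.**  The set of `u ∈ U(σ_{w₁}J)(ℂ)` whose four frame coordinates
`(πt(u v₀), πv(u v₀), πt(u t₀), πv(u t₀))` have sum of squared moduli `≤ R` is COMPACT: the coordinates determine the matrix linearly
and injectively (a closed embedding of the finite-dimensional `M₂(ℂ)`), and `U → M₂(ℂ)` is a closed embedding. [cite: PlatonovRapinchuk1994, §3.2] -/
theorem isCompact_frameCoords_le (hvt : star 𝔣.v₀ ⬝ᵥ (J.map w₁.1.embedding *ᵥ 𝔣.t₀) = 0) {πt πv : (Fin 2 → ℂ) →ₗ[ℂ] ℂ}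
    (hdec : ∀ w, w = πt w • 𝔣.t₀ + πv w • 𝔣.v₀) (R : ℝ) :
    IsCompact {u : archLocal E 2 J w₁ |
      ‖πt (((u : GL (Fin 2) ℂ) : Matrix (Fin 2) (Fin 2) ℂ) *ᵥ 𝔣.v₀)‖ ^ 2 +
        ‖πv (((u : GL (Fin 2) ℂ) : Matrix (Fin 2) (Fin 2) ℂ) *ᵥ 𝔣.v₀)‖ ^ 2 +
        ‖πt (((u : GL (Fin 2) ℂ) : Matrix (Fin 2) (Fin 2) ℂ) *ᵥ 𝔣.t₀)‖ ^ 2 +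
        ‖πv (((u : GL (Fin 2) ℂ) : Matrix (Fin 2) (Fin 2) ℂ) *ᵥ 𝔣.t₀)‖ ^ 2 ≤ R} := by
  -- the linear coordinate map `M ↦ ((πt(Mv₀), πv(Mv₀)), (πt(Mt₀), πv(Mt₀)))`
  let Ψ : Matrix (Fin 2) (Fin 2) ℂ →ₗ[ℂ] (ℂ × ℂ) × (ℂ × ℂ) :=
    { toFun := fun M => ((πt (M *ᵥ 𝔣.v₀), πv (M *ᵥ 𝔣.v₀)), (πt (M *ᵥ 𝔣.t₀), πv (M *ᵥ 𝔣.t₀)))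
      map_add' := fun M M' => by simp only [add_mulVec, map_add, Prod.mk_add_mk]
      map_smul' := fun r M => by
        simp only [smul_mulVec, map_smul, smul_eq_mul, RingHom.id_apply, Prod.smul_mk] }
  have hΨinj : LinearMap.ker Ψ = ⊥ := by
    rw [LinearMap.ker_eq_bot]
    intro M M' hMM'
    simp only [Ψ, LinearMap.coe_mk, AddHom.coe_mk, Prod.mk.injEq] at hMM'
    refine eq_of_mulVec_frame hdec ?_ ?_
    · rw [hdec (M *ᵥ 𝔣.v₀), hdec (M' *ᵥ 𝔣.v₀), hMM'.1.1, hMM'.1.2]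
    · rw [hdec (M *ᵥ 𝔣.t₀), hdec (M' *ᵥ 𝔣.t₀), hMM'.2.1, hMM'.2.2]
  have hΨ : Topology.IsClosedEmbedding Ψ := LinearMap.isClosedEmbedding_of_injective hΨinj
  -- the compact target
  set T : Set ((ℂ × ℂ) × (ℂ × ℂ)) := {z | ‖z.1.1‖ ^ 2 + ‖z.1.2‖ ^ 2 + ‖z.2.1‖ ^ 2 + ‖z.2.2‖ ^ 2 ≤ R} with hT
  have hTc : IsCompact T := by
    refine (isCompact_closedBall (0 : (ℂ × ℂ) × (ℂ × ℂ)) (Real.sqrt (max R 0))).of_isClosed_subset ?_ ?_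
    · exact isClosed_le (by fun_prop) continuous_const
    · intro z hz
      simp only [Set.mem_setOf_eq, hT] at hz
      have hb : ∀ t : ℂ, ‖t‖ ^ 2 ≤ max R 0 → ‖t‖ ≤ Real.sqrt (max R 0) := fun t ht =>
        Real.le_sqrt_of_sq_le ht
      rw [Metric.mem_closedBall, dist_zero_right]
      refine max_le (max_le (hb _ ?_) (hb _ ?_)) (max_le (hb _ ?_) (hb _ ?_)) <;>
        nlinarith [sq_nonneg ‖z.1.1‖, sq_nonneg ‖z.1.2‖, sq_nonneg ‖z.2.1‖, sq_nonneg ‖z.2.2‖, le_max_left R 0,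
          le_max_right R 0]
  have hS : IsCompact (Ψ ⁻¹' T) := hΨ.isCompact_preimage hTc
  exact (isClosedEmbedding_coe_archLocal (isUnit_form_of_orth hvt)).isCompact_preimage hS


/-! ## §3 The rotation average (abstract): `∫ α · F(ζ) dν = F(0) · ∫ α dν` -/

/-- **ROTATION AVERAGE.**  Let `ν` be a left-invariant measure, finite on compacts, on a topological group `U`; `α : U → ℝ` continuous with
compact support and `ζ : U → ℂ` continuous with values in the disc `|ζ| < r`; `F` holomorphic on that disc.  If for every angle `θ` some
`k ∈ U` fixes `α` and ROTATES `ζ` by `e^{iθ}` under left translation, then `∫ α(u) F(ζ(u)) dν(u) = F(0) ∫ α dν`: by left-invariance the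
integral is unchanged when `ζ` is replaced by `e^{iθ} ζ`, so it equals its average over `θ ∈ [0, 2π]`, which by Fubini (the integrand is
continuous with compact support) is `∫ α(u) · circleAverage F 0 |ζ(u)| dν(u)`, and the circle average of a holomorphic function is its value
at the centre (Mathlib `DiffContOnCl.circleAverage`). [cite: Borel1997, §2.13–2.14] [cite: HarishChandra1966, §8, Thm. 1] -/
theorem integral_mul_eq_mul_integral_of_rotation {U : Type*} [Group U] [TopologicalSpace U] [IsTopologicalGroup U]
    [MeasurableSpace U] [BorelSpace U] (ν : Measure U) [ν.IsMulLeftInvariant] [IsFiniteMeasureOnCompacts ν]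
    {α : U → ℝ} {ζ : U → ℂ} {F : ℂ → ℂ} {r : ℝ}
    (hαc : Continuous α) (hαs : HasCompactSupport α) (hζc : Continuous ζ) (hζr : ∀ u, ‖ζ u‖ < r)
    (hF : DifferentiableOn ℂ F (Metric.ball 0 r))
    (hrot : ∀ θ : ℝ, ∃ k : U, (∀ u, α (k * u) = α u) ∧ ∀ u, ζ (k * u) = Complex.exp (θ * Complex.I) * ζ u) :
    ∫ u, (α u : ℂ) * F (ζ u) ∂ν = F 0 * ∫ u, (α u : ℂ) ∂ν := by
  set K := tsupport α with hK
  have hKc : IsCompact K := hαs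
  -- the two-variable integrand
  set g : ℝ → U → ℂ := fun θ u => (α u : ℂ) * F (Complex.exp (θ * Complex.I) * ζ u) with hg
  have hexp1 : ∀ θ : ℝ, ‖Complex.exp (θ * Complex.I)‖ = 1 := fun θ => by
    rw [Complex.norm_exp_ofReal_mul_I]
  have hball : ∀ (θ : ℝ) (u : U), Complex.exp (θ * Complex.I) * ζ u ∈ Metric.ball (0 : ℂ) r := fun θ u => by
    rw [Metric.mem_ball, dist_zero_right, norm_mul, hexp1, one_mul]; exact hζr u
  have hFc : ContinuousOn F (Metric.ball 0 r) := hF.continuousOn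
  -- (1) rotation invariance of the integral
  have hstep1 : ∀ θ : ℝ, ∫ u, (α u : ℂ) * F (ζ u) ∂ν = ∫ u, g θ u ∂ν := by
    intro θ
    obtain ⟨k, hkα, hkζ⟩ := hrot θ
    rw [← integral_mul_left_eq_self (fun u => (α u : ℂ) * F (ζ u)) k]
    refine integral_congr_ae (Filter.Eventually.of_forall fun u => ?_)
    simp only [hg, hkα u, hkζ u]
  -- (2) continuity and a global bound for `g`
  have hgc : Continuous (Function.uncurry g) := by
    have h1 : Continuous fun p : ℝ × U => (α p.2 : ℂ) := Complex.continuous_ofReal.comp (hαc.comp continuous_snd)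
    have h2 : Continuous fun p : ℝ × U => Complex.exp (p.1 * Complex.I) * ζ p.2 :=
      (Complex.continuous_exp.comp ((Complex.continuous_ofReal.comp continuous_fst).mul continuous_const)).mul
        (hζc.comp continuous_snd)
    have h3 : Continuous fun p : ℝ × U => F (Complex.exp (p.1 * Complex.I) * ζ p.2) :=
      hFc.comp_continuous h2 fun p => hball p.1 p.2
    exact h1.mul h3
  obtain ⟨R, hRr, hR⟩ : ∃ R < r, ζ '' K ⊆ Metric.ball 0 R :=
    exists_lt_subset_ball (hKc.image hζc).isClosed
      (by rintro _ ⟨u, -, rfl⟩; rw [Metric.mem_ball, dist_zero_right]; exact hζr u)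
  obtain ⟨B₀, hB₀⟩ : ∃ B, ∀ z ∈ Metric.closedBall (0 : ℂ) R, ‖F z‖ ≤ B :=
    (isCompact_closedBall (0 : ℂ) R).exists_bound_of_continuousOn
      (hFc.mono (Metric.closedBall_subset_ball hRr))
  set B := max B₀ 0 with hBdef
  have hB : ∀ z ∈ Metric.closedBall (0 : ℂ) R, ‖F z‖ ≤ B := fun z hz => (hB₀ z hz).trans (le_max_left _ _)
  have hB0 : 0 ≤ B := le_max_right _ _
  obtain ⟨A, hA⟩ : ∃ A, ∀ u, ‖α u‖ ≤ A := hαs.exists_bound_of_continuous hαc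
  have hbound : ∀ θ u, ‖g θ u‖ ≤ A * B := by
    intro θ u
    have hA0 : 0 ≤ A := (norm_nonneg _).trans (hA u)
    by_cases hu : u ∈ K
    · have hz : Complex.exp (θ * Complex.I) * ζ u ∈ Metric.closedBall (0 : ℂ) R := by
        rw [Metric.mem_closedBall, dist_zero_right, norm_mul, hexp1, one_mul]
        exact le_of_lt (by simpa [Metric.mem_ball, dist_zero_right] using hR ⟨u, hu, rfl⟩)
      rw [hg, norm_mul, Complex.norm_real]
      exact mul_le_mul (hA u) (hB _ hz) (norm_nonneg _) hA0
    · have h0 : α u = 0 := image_eq_zero_of_notMem_tsupport hu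
      simp only [hg, h0, Complex.ofReal_zero, zero_mul, norm_zero]
      exact mul_nonneg hA0 hB0
  -- (3) `g θ ·` vanishes off `K`, so its integral is an integral over the finite measure `ν.restrict K`
  have hgK : ∀ θ, ∀ u ∉ K, g θ u = 0 := fun θ u hu => by
    simp only [hg, image_eq_zero_of_notMem_tsupport hu, Complex.ofReal_zero, zero_mul]
  have hνK : ν K < ⊤ := hKc.measure_lt_top
  haveI : IsFiniteMeasure (ν.restrict K) := ⟨by rw [Measure.restrict_apply_univ]; exact hνK⟩
  have hstep3 : ∀ θ, ∫ u, g θ u ∂ν = ∫ u, g θ u ∂(ν.restrict K) := fun θ =>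
    (setIntegral_eq_integral_of_forall_compl_eq_zero (hgK θ)).symm
  -- (4) Fubini on `[0, 2π] × K`
  set μθ : Measure ℝ := volume.restrict (Set.Ioc 0 (2 * Real.pi)) with hμθ
  have hint : Integrable (Function.uncurry g) (μθ.prod (ν.restrict K)) := by
    refine (integrable_const (A * B)).mono' hgc.aestronglyMeasurable (Filter.Eventually.of_forall fun p => ?_)
    exact hbound p.1 p.2
  have hswap : ∫ θ, ∫ u, g θ u ∂(ν.restrict K) ∂μθ = ∫ u, ∫ θ, g θ u ∂μθ ∂(ν.restrict K) :=
    integral_integral_swap hint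
  -- (5) the inner `θ`-integral is a circle average
  have hinner : ∀ u, ∫ θ, g θ u ∂μθ = (α u : ℂ) * ((2 * Real.pi) * F 0) := by
    intro u
    rw [hμθ, ← intervalIntegral.integral_of_le Real.two_pi_pos.le]
    simp only [hg]
    rw [intervalIntegral.integral_const_mul]
    congr 1
    -- `∫_0^{2π} F(e^{iθ} ζ) dθ = ∫_0^{2π} F(circleMap 0 ‖ζ‖ θ) dθ = 2π · circleAverage F 0 ‖ζ‖ = 2π · F 0`
    have hper : Function.Periodic (fun θ : ℝ => F (circleMap 0 ‖ζ u‖ θ)) (2 * Real.pi) :=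
      (periodic_circleMap 0 ‖ζ u‖).comp F
    have hrw : ∀ θ : ℝ, F (Complex.exp (θ * Complex.I) * ζ u) =
        (fun θ' : ℝ => F (circleMap 0 ‖ζ u‖ θ')) (θ + Complex.arg (ζ u)) := by
      intro θ
      simp only [circleMap, zero_add]
      congr 1
      conv_lhs => rw [← Complex.norm_mul_exp_arg_mul_I (ζ u)]
      rw [Complex.ofReal_add, add_mul, Complex.exp_add]
      ring
    simp_rw [hrw]
    rw [intervalIntegral.integral_comp_add_right (fun θ' : ℝ => F (circleMap 0 ‖ζ u‖ θ')), zero_add,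
      add_comm (2 * Real.pi) (Complex.arg (ζ u)), hper.intervalIntegral_add_eq (Complex.arg (ζ u)) 0, zero_add]
    have hDC : DiffContOnCl ℂ F (Metric.ball 0 |‖ζ u‖|) := by
      refine DifferentiableOn.diffContOnCl (hF.mono ?_)
      rw [abs_norm]
      exact (Metric.closure_ball_subset_closedBall).trans (Metric.closedBall_subset_ball (hζr u))
    have hca := hDC.circleAverage
    rw [Real.circleAverage_def, Complex.real_smul] at hca
    have h2π : (2 * Real.pi : ℝ) ≠ 0 := Real.two_pi_pos.ne'
    have := congrArg (fun z : ℂ => ((2 * Real.pi : ℝ) : ℂ) * z) hca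
    rw [← mul_assoc, ← Complex.ofReal_mul, mul_inv_cancel₀ h2π, Complex.ofReal_one, one_mul] at this
    rw [this]
    push_cast
    ring
  -- (6) assemble
  have h2π : ((2 * Real.pi : ℝ) : ℂ) ≠ 0 := by exact_mod_cast Real.two_pi_pos.ne'
  have hconst : ∫ θ, (∫ u, (α u : ℂ) * F (ζ u) ∂ν) ∂μθ = ((2 * Real.pi : ℝ) : ℂ) * ∫ u, (α u : ℂ) * F (ζ u) ∂ν := by
    rw [integral_const, measureReal_def, hμθ, Measure.restrict_apply_univ, Real.volume_Ioc, sub_zero,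
      ENNReal.toReal_ofReal Real.two_pi_pos.le, Complex.real_smul]
  have hmain : ((2 * Real.pi : ℝ) : ℂ) * ∫ u, (α u : ℂ) * F (ζ u) ∂ν =
      ((2 * Real.pi : ℝ) : ℂ) * (F 0 * ∫ u, (α u : ℂ) ∂ν) := by
    rw [← hconst]
    have : ∫ θ, (∫ u, (α u : ℂ) * F (ζ u) ∂ν) ∂μθ = ∫ θ, ∫ u, g θ u ∂(ν.restrict K) ∂μθ :=
      integral_congr_ae (Filter.Eventually.of_forall fun θ => by rw [hstep1 θ, hstep3 θ])
    rw [this, hswap]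
    simp_rw [hinner]
    rw [integral_mul_const, setIntegral_eq_integral_of_forall_compl_eq_zero (fun u hu => by
      rw [image_eq_zero_of_notMem_tsupport hu, Complex.ofReal_zero])]
    push_cast
    ring
  exact mul_left_cancel₀ h2π hmain


end Literature.NumberTheory.Automorphic.UnitaryCurveForms

end
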